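import Summits.AnomalousDissipation.AnomalousDissipation.Theorems.TwoAndHalfDTwohalfdNegRegularCondensateEndgame
import Literature.Analysis.FluidPDE.PassiveScalarForcedTransportEnergySobolev
import Literature.Analysis.FluidPDE.PassiveScalarForcedClass
import Literature.Analysis.FluidPDE.DEIJCriterion

/-!
# Sobolev-condensate no-go for `TwoAndHalfD.TwohalfdThesis` (stmt-AnomalousDissipation-0206), stub SC-CON:
# the block limit cannot live on a long block — SOBOLEV drift

Crux `TwohalfdThesis` (= X), line `Sketch`, lead c7, section N of the skeleton (Sobolev condensates).  This is
the sibling crux's RC-CON (`Theorems.TwohalfdNeg.RegularCondensate.stub_rcContradiction`, 0211-c7) with the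
LIPSCHITZ conservative balance replaced by the κ = 0 DiPerna–Lions balance for SOBOLEV drifts landed by this lead
(`Literature.Analysis.FluidPDE.Torus.IsWeakScalarTransportForcedOn.integral_sq_eq_of_lintegral_eGradNormSq_rpow_lt_top`,
p136128): the block limit `Θ ∈ L^∞(0,S; L²(T²))`, a weak solution of the sourced TRANSPORT equation
`∂ₜΘ + W'·∇Θ = h` on `T² × [0,S)` whose drift has `∫₀^S ‖∇W'(t)‖_{L²} dt < ∞` (no continuity, no Lipschitz
bound), with `∫∫_{(0,S)×T²} Θ² ≤ 2ΛS` and `∫∫_{(0,S)×T²} Θ h ≥ cS`, forces `S ≤ 2Λ(c² + 8‖h‖²_{L²}Λ)/c³`.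

Proof: verbatim the RC-CON glue — conservative balance `‖Θ(t)‖² = ‖Θ₀‖² + 2∫_{(0,t]}∫Θh` a.e. (Sobolev form),
then 0211-c7's ODE endgame `stub_rcEndgame` with `p = ∫Θ(·)h`, `e = ½‖Θ₀‖² + ∫₀ᵗ p`, `M = √(2∫h²)`.

* `stub_scContradiction` — the registered stub (last declaration).  Supports stmt-AnomalousDissipation-0206.

## References

* R. J. DiPerna, P.-L. Lions, Invent. Math. 98 (1989), §II.3, Thm. II.3. [`DiPernaLions1989`]
-/

namespace Summit.AnomalousDissipation.AnomalousDissipation.Theorems.TwohalfdThesis.SobolevCondensate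

open MeasureTheory Filter Topology
open scoped ENNReal NNReal InnerProductSpace
open Literature.Analysis.FunctionSpaces Literature.Analysis.FluidPDE
open Summit.AnomalousDissipation.AnomalousDissipation.Theorems.TwohalfdNeg.RegularCondensate

set_option linter.dupNamespace false -- the registry path `AnomalousDissipation.AnomalousDissipation` (summit = problem)

/-- **SC-CON `stub_scContradiction` — the block limit cannot live on a long block, Sobolev drift
(registered stub).** For a weak solution `Θ ∈ L^∞(0,S; L²)` of the sourced transport equation
`∂ₜΘ + W'·∇Θ = h` on `T² × [0,S)` whose drift satisfies `∫₀^S ‖∇W'(t)‖_{L²} dt < ∞` (spectral), with an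
`L²` datum and a smooth steady source, if `∫∫_{(0,S)×T²} Θ² ≤ 2ΛS` and `∫∫_{(0,S)×T²} Θ h ≥ cS`
(`c > 0`, `Λ ≥ 0`), then `S ≤ 2Λ(c² + 8(∫h²)Λ)/c³`: the Sobolev conservative balance feeds the ODE
endgame `stub_rcEndgame` with `p = ∫ Θ(·) h`, `e = ½‖Θ₀‖² + ∫₀ᵗ p`, `e₀ = ½‖Θ₀‖²`, `M = √(2∫h²)`.
[cite: DiPernaLions1989, §II.3 Thm. II.3] -/
theorem stub_scContradiction :
    ∀ (S c Λ : ℝ) (h : UnitAddTorus (Fin 2) → ℝ)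
      (W' : ℝ → UnitAddTorus (Fin 2) → EuclideanSpace ℝ (Fin 2))
      (Θ₀ : UnitAddTorus (Fin 2) → ℝ) (Θ : ℝ → UnitAddTorus (Fin 2) → ℝ),
      0 < S → 0 < c → 0 ≤ Λ → Torus.IsSmooth h → MemLp Θ₀ 2 volume →
      (∫⁻ t in Set.Ioo 0 S, Torus.eGradNormSq (W' t) ^ (1 / 2 : ℝ) < ⊤) →
      Torus.IsWeakScalarTransportForcedOn S 0 W' (fun _ => h) Θ₀ Θ →
      AEStronglyMeasurable (Function.uncurry Θ) (((volume : Measure ℝ).restrict (Set.Ioo 0 S)).prod volume) →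
      Integrable (fun p : ℝ × UnitAddTorus (Fin 2) => Θ p.1 p.2 ^ 2)
        (((volume : Measure ℝ).restrict (Set.Ioo 0 S)).prod volume) →
      ∫ p, Θ p.1 p.2 ^ 2 ∂(((volume : Measure ℝ).restrict (Set.Ioo 0 S)).prod volume) ≤ 2 * Λ * S →
      c * S ≤ ∫ p, Θ p.1 p.2 * h p.2 ∂(((volume : Measure ℝ).restrict (Set.Ioo 0 S)).prod volume) →
      S ≤ 2 * Λ * (c ^ 2 + 8 * (∫ x, h x ^ 2) * Λ) / c ^ 3 := by
  intro S c Λ h W' Θ₀ Θ hS hc hΛ hh hΘ₀ hG hsol _hΘm hint hlev hpow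
  -- the power, the level and the Cauchy–Schwarz constant
  set p : ℝ → ℝ := fun τ => ∫ x, Θ τ x * h x with hp_def
  set e₀ : ℝ := (∫ x, Θ₀ x ^ 2) / 2 with he₀_def
  set e : ℝ → ℝ := fun t => e₀ + ∫ τ in Set.Ioc 0 t, p τ with he_def
  set M : ℝ := Real.sqrt (2 * ∫ x, h x ^ 2) with hM_def
  -- (Z): the conservative balance `‖Θ(t)‖² = ‖Θ₀‖² + 2∫₀ᵗ p` for a.e. `t ∈ (0,S)` (Sobolev drift)
  have hZ : ∀ᵐ t ∂(volume.restrict (Set.Ioo 0 S)),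
      ∫ x, Θ t x ^ 2 = (∫ x, Θ₀ x ^ 2) + 2 * ∫ τ in Set.Ioc 0 t, p τ :=
    hsol.integral_sq_eq_of_lintegral_eGradNormSq_rpow_lt_top hh hΘ₀ hG
  -- hence `e(t) = ½‖Θ(t)‖²` for a.e. `t ∈ (0,S)`
  have he_ae : ∀ᵐ t ∂(volume.restrict (Set.Ioo 0 S)), e t = (∫ x, Θ t x ^ 2) / 2 := by
    filter_upwards [hZ] with t ht
    rw [ht, he_def, he₀_def]
    ring
  -- (i) integrability of the power: `Θ h ∈ L¹((0,S) × T²)` and Fubini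
  have hΘh : Integrable (fun q : ℝ × UnitAddTorus (Fin 2) => Θ q.1 q.2 * h q.2)
      (((volume : Measure ℝ).restrict (Set.Ioo 0 S)).prod volume) :=
    hsol.integrable_mul_continuous hh.continuous
  have hpIoo : IntegrableOn p (Set.Ioo 0 S) volume := hΘh.integral_prod_left
  have hp : IntegrableOn p (Set.Ioc 0 S) volume :=
    (integrableOn_Ioc_iff_integrableOn_Ioo (f := p)).2 hpIoo
  -- (ii) the balance law, by definition of `e`
  have he : ∀ t ∈ Set.Icc 0 S, e t = e₀ + ∫ τ in Set.Ioc 0 t, p τ := fun t _ => rfl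
  -- continuity of `e` on `[0, S]` (primitive of an integrable function)
  have hpI : IntervalIntegrable p volume 0 S :=
    (intervalIntegrable_iff_integrableOn_Ioc_of_le hS.le).2 hp
  have hec : ContinuousOn e (Set.Icc 0 S) := by
    have h1 : ContinuousOn (fun t => e₀ + ∫ τ in (0 : ℝ)..t, p τ) (Set.uIcc 0 S) :=
      continuousOn_const.add
        (intervalIntegral.continuousOn_primitive_interval' hpI Set.left_mem_uIcc)
    rw [Set.uIcc_of_le hS.le] at h1
    refine h1.congr fun t ht => ?_
    show e₀ + ∫ τ in Set.Ioc 0 t, p τ = e₀ + ∫ τ in (0 : ℝ)..t, p τ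
    rw [intervalIntegral.integral_of_le ht.1]
  -- (iii) `e ≥ 0` on all of `[0, S]`: `e = |e|` a.e. on `[0, S]`, both sides continuous
  have he0 : ∀ t ∈ Set.Icc 0 S, 0 ≤ e t := by
    have hae : e =ᵐ[volume.restrict (Set.Icc 0 S)] fun t => |e t| := by
      rw [← restrict_Ioo_eq_restrict_Icc]
      filter_upwards [he_ae] with t ht
      rw [ht, abs_of_nonneg (by positivity)]
    have heq := Measure.eqOn_Icc_of_ae_eq volume hS.ne hae hec
      (continuous_abs.comp_continuousOn hec)
    intro t ht
    rw [heq ht]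
    exact abs_nonneg _
  -- (iv) Cauchy–Schwarz: `|p(τ)| ≤ ‖Θ(τ)‖ ‖h‖ = M √(e(τ))` for a.e. `τ`
  have hpM : ∀ᵐ τ ∂(volume.restrict (Set.Ioc 0 S)), |p τ| ≤ M * Real.sqrt (e τ) := by
    rw [← restrict_Ioo_eq_restrict_Ioc]
    filter_upwards [he_ae, hsol.ae_memLp_two] with τ hτ hm2
    have hcs := Torus.DEIJ.abs_integral_mul_le_sqrt hm2 (hh.memLp 2)
    have h2e : ∫ x, Θ τ x ^ 2 = 2 * e τ := by rw [hτ]; ring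
    calc |p τ| = |∫ x, Θ τ x * h x| := rfl
      _ ≤ Real.sqrt (∫ x, Θ τ x ^ 2) * Real.sqrt (∫ x, h x ^ 2) := hcs
      _ = M * Real.sqrt (e τ) := by
          rw [h2e, hM_def, Real.sqrt_mul zero_le_two, Real.sqrt_mul zero_le_two]
          ring
  -- (v) the total power is the space–time integral of `Θ h` (Fubini)
  have hpow' : c * S ≤ ∫ τ in Set.Ioc 0 S, p τ := by
    rw [integral_Ioc_eq_integral_Ioo, ← integral_prod _ hΘh]
    exact hpow
  -- (vi) the mean level is half the space–time integral of `Θ²` (Fubini)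
  have hlev' : ∫ t in Set.Ioc 0 S, e t ≤ Λ * S := by
    rw [integral_Ioc_eq_integral_Ioo, integral_congr_ae he_ae, integral_div,
      ← integral_prod _ hint]
    linarith
  -- the endgame (E)
  have hM : 0 ≤ M := Real.sqrt_nonneg _
  have he₀ : 0 ≤ e₀ := by positivity
  have key := stub_rcEndgame e p e₀ c Λ M S hc hΛ hM hS he₀ hp he he0 hpM hpow' hlev'
  have hM2 : M ^ 2 = 2 * ∫ x, h x ^ 2 := Real.sq_sqrt (by positivity)
  calc S ≤ 2 * Λ * (c ^ 2 + 4 * M ^ 2 * Λ) / c ^ 3 := key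
    _ = 2 * Λ * (c ^ 2 + 8 * (∫ x, h x ^ 2) * Λ) / c ^ 3 := by rw [hM2]; ring

end Summit.AnomalousDissipation.AnomalousDissipation.Theorems.TwohalfdThesis.SobolevCondensate
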